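import Literature.NumberTheory.Transcendental.KZLogCalculusProofs
import Literature.NumberTheory.Transcendental.SemialgebraicDerivativeProofs

/-!
# `LogPrimitiveNL` (stmt-KontsevichZagierPeriods-2836) — line `logderiv-peeling`,
stub `stub_minNormalisation` (T1, min-normalisation)

Over a `ℚ`-semialgebraic base `τ ⊆ ℝⁿ` with `ℚ`-semialgebraic edges `a ≤ b`, let `V > 0` be
`ℚ`-semialgebraic on the closed band `{(x,t) | x ∈ τ, a x ≤ t ≤ b x}`, continuous on the closed
fibres and differentiable on the open fibres with derivative `V'`, and let `h` be `ℚ`-semialgebraic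
on `τ` with `h V'/V` integrable on the band. Then the fibre minimum
`m x = min_{t ∈ [a x, b x]} V (x, t)` is `ℚ`-semialgebraic on `τ` (its graph is first-order definable
from the graph of `V`; Tarski–Seidenberg with rational coefficients, the formula kit of
`SemialgebraicDerivativeProofs.lean`), `0 < m ≤ V` on the band, and the two min-normalised endpoint
monomials `h · log (V(·, b)/m)`, `h · log (V(·, a)/m)` are integrable on `τ`: by the fundamental
theorem of calculus for `log V(x, ·)` between the argmin `t*` and the endpoint, each is dominated by
the fibre integral `∫_{[a x, b x]} |h x V'/V| dt`, which is integrable over `τ` by Tonelli along the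
last coordinate (`MeasureTheory.volume_preserving_piFinSuccAbove`,
`MeasureTheory.Integrable.integral_norm_prod_right`).

This is the remedy for the trap instance of `Cruxes/LogPrimitiveNL/Disproof.lean` §7.2(b): the raw
endpoint monomials `h · log V(·, b)` need not be integrable, the min-normalised ones always are.
-/

noncomputable section

open Set MeasureTheory Filter
open Literature.NumberTheory.Transcendental Literature.ModelTheory.ExponentialFields
open Literature.NumberTheory.Transcendental.SemialgebraicDerivative

namespace Summit.KontsevichZagierPeriods.LiouvilleUnfolding.LogPrimitiveNL

/-! ### Semialgebraic part: the formula kit with rational coefficients -/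

/-- The atom `z i ≤ z j` is `ℚ`-semialgebraic. [folklore] -/
private theorem minNorm_sa_le {N : ℕ} (i j : Fin N) :
    IsSemialgebraic ℚ {z : Fin N → ℝ | z i ≤ z j} := by
  simpa using isSemialgebraic_setOf_eval_le (k := ℚ) (R := ℝ)
    (MvPolynomial.X i : MvPolynomial (Fin N) ℚ) (MvPolynomial.X j)

/-- **Semialgebraicity of a fibre minimum.** If `V` is `ℚ`-semialgebraic on the band over `τ` with
edges `a`, `b`, and `m x` is, for every `x ∈ τ`, a value `V (x, t)` (`t ∈ [a x, b x]`) that is a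
lower bound of `V (x, ·)` on `[a x, b x]`, then `m` is `ℚ`-semialgebraic on `τ`: its graph is
`{(x, y) | x ∈ τ ∧ (∃ s, (x, s) ∈ band ∧ y = V (x, s)) ∧ ∀ s u, ((x, s) ∈ band ∧ u = V (x, s)) → y ≤ u}`,
a first-order formula over the `ℚ`-semialgebraic graph of `V` (Basu–Pollack–Roy, Cor. 2.78).
[folklore] -/
theorem minNorm_isSemialgebraicFunOn_of_fibreMin {n : ℕ} {τ : Set (Fin n → ℝ)}
    {a b : (Fin n → ℝ) → ℝ} {V : (Fin (n + 1) → ℝ) → ℝ} {m : (Fin n → ℝ) → ℝ}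
    (hτ : IsSemialgebraic ℚ τ) (hV : IsSemialgebraicFunOn ℚ (KZlog.band τ a b) V)
    (h1 : ∀ x ∈ τ, ∃ t ∈ Icc (a x) (b x), m x = V (Fin.snoc x t))
    (h2 : ∀ x ∈ τ, ∀ t ∈ Icc (a x) (b x), m x ≤ V (Fin.snoc x t)) :
    IsSemialgebraicFunOn ℚ τ m := by
  rw [isSemialgebraicFunOn_iff] at hV ⊢
  suffices key : IsSemialgebraic ℚ {q : Fin (n + 1) → ℝ | Fin.init q ∈ τ ∧
      (∃ s : ℝ, (Fin.snoc (Fin.init q) s : Fin (n + 1) → ℝ) ∈ KZlog.band τ a b ∧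
        q (Fin.last n) = V (Fin.snoc (Fin.init q) s)) ∧
      ∀ s u : ℝ, ((Fin.snoc (Fin.init q) s : Fin (n + 1) → ℝ) ∈ KZlog.band τ a b ∧
        u = V (Fin.snoc (Fin.init q) s)) → q (Fin.last n) ≤ u} by
    convert key using 1
    refine Set.ext fun q => ?_
    simp only [mem_setOf_eq]
    constructor
    · rintro ⟨hx, hq⟩
      obtain ⟨t, ht, hmt⟩ := h1 _ hx
      refine ⟨hx, ⟨t, KZlog.snoc_mem_band.2 ⟨hx, ht⟩, hq.trans hmt⟩, ?_⟩
      rintro s u ⟨hs, rfl⟩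
      rw [hq]
      exact h2 _ hx s (KZlog.snoc_mem_band.1 hs).2
    · rintro ⟨hx, ⟨t, ht, hqt⟩, hlow⟩
      refine ⟨hx, le_antisymm ?_ ?_⟩
      · obtain ⟨t₀, ht₀, hmt₀⟩ := h1 _ hx
        rw [hmt₀]
        exact hlow t₀ _ ⟨KZlog.snoc_mem_band.2 ⟨hx, ht₀⟩, rfl⟩
      · rw [hqt]
        exact h2 _ hx t (KZlog.snoc_mem_band.1 ht).2
  refine sa_and hτ.setOf_init_mem (sa_and ?_ ?_)
  · exact sa_exists (sa_graph₂ hV _ _ _)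
  · exact sa_forall (sa_forall (sa_imp (sa_graph₂ hV _ _ _) (minNorm_sa_le _ _)))

/-- **Evaluation along a semialgebraic section of the band.** If `V` is `ℚ`-semialgebraic on the
band over `τ` with edges `a`, `b` and `ρ` is a `ℚ`-semialgebraic function on `τ` with
`a ≤ ρ ≤ b`, then `x ↦ V (x, ρ x)` is `ℚ`-semialgebraic on `τ` (graph
`{(x, y) | x ∈ τ ∧ ∃ u, u = ρ x ∧ (x, u) ∈ band ∧ y = V (x, u)}`). [folklore] -/
theorem minNorm_isSemialgebraicFunOn_comp_section {n : ℕ} {τ : Set (Fin n → ℝ)}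
    {a b ρ : (Fin n → ℝ) → ℝ} {V : (Fin (n + 1) → ℝ) → ℝ}
    (hτ : IsSemialgebraic ℚ τ) (hρ : IsSemialgebraicFunOn ℚ τ ρ)
    (hρmem : ∀ x ∈ τ, ρ x ∈ Icc (a x) (b x))
    (hV : IsSemialgebraicFunOn ℚ (KZlog.band τ a b) V) :
    IsSemialgebraicFunOn ℚ τ (fun x => V (Fin.snoc x (ρ x))) := by
  rw [isSemialgebraicFunOn_iff] at hρ hV ⊢
  suffices key : IsSemialgebraic ℚ {q : Fin (n + 1) → ℝ | Fin.init q ∈ τ ∧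
      ∃ u : ℝ, (Fin.init q ∈ τ ∧ u = ρ (Fin.init q)) ∧
        ((Fin.snoc (Fin.init q) u : Fin (n + 1) → ℝ) ∈ KZlog.band τ a b ∧
          q (Fin.last n) = V (Fin.snoc (Fin.init q) u))} by
    convert key using 1
    refine Set.ext fun q => ?_
    simp only [mem_setOf_eq]
    constructor
    · rintro ⟨hx, hq⟩
      exact ⟨hx, ρ (Fin.init q), ⟨hx, rfl⟩, KZlog.snoc_mem_band.2 ⟨hx, hρmem _ hx⟩, hq⟩
    · rintro ⟨hx, u, ⟨-, rfl⟩, -, hq⟩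
      exact ⟨hx, hq⟩
  exact sa_and hτ.setOf_init_mem (sa_exists (sa_and (sa_graph₁ hρ _ _) (sa_graph₂ hV _ _ _)))

/-! ### Calculus part: the endpoint estimate and Tonelli along the last coordinate -/

/-- **Endpoint estimate.** For `W > 0` continuous on `[a, b]` with derivative `W'` on `(a, b)` and
`W'/W` integrable on `[a, b]`: `|log (W ρ / W t₀)| ≤ ∫_{[a,b]} |W'/W|` for all `ρ, t₀ ∈ [a, b]`
(fundamental theorem of calculus for `log ∘ W` between `t₀` and `ρ`). [folklore] -/
theorem minNorm_abs_log_div_le_integral {W W' : ℝ → ℝ} {a b ρ t₀ : ℝ}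
    (hcont : ContinuousOn W (Icc a b)) (hpos : ∀ t ∈ Icc a b, 0 < W t)
    (hder : ∀ t ∈ Ioo a b, HasDerivAt W (W' t) t)
    (hint : IntegrableOn (fun t => W' t / W t) (Icc a b))
    (hρ : ρ ∈ Icc a b) (ht₀ : t₀ ∈ Icc a b) :
    |Real.log (W ρ / W t₀)| ≤ ∫ t in Icc a b, |W' t / W t| := by
  have hsub : uIcc t₀ ρ ⊆ Icc a b := uIcc_subset_Icc ht₀ hρ
  have hc : ContinuousOn (fun t => Real.log (W t)) (uIcc t₀ ρ) :=
    (hcont.mono hsub).log fun t ht => (hpos t (hsub ht)).ne'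
  have hd : ∀ t ∈ Ioo (min t₀ ρ) (max t₀ ρ),
      HasDerivWithinAt (fun t => Real.log (W t)) (W' t / W t) (Ioi t) t := by
    intro t ht
    have ht' : t ∈ Ioo a b :=
      ⟨(le_min ht₀.1 hρ.1).trans_lt ht.1, ht.2.trans_le (max_le ht₀.2 hρ.2)⟩
    exact ((hder t ht').log (hpos t (Ioo_subset_Icc_self ht')).ne').hasDerivWithinAt
  have hFTC := intervalIntegral.integral_eq_sub_of_hasDeriv_right hc hd
    (hint.mono_set hsub).intervalIntegrable
  rw [Real.log_div (hpos ρ hρ).ne' (hpos t₀ ht₀).ne', ← hFTC, ← Real.norm_eq_abs]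
  calc ‖∫ t in t₀..ρ, W' t / W t‖ ≤ ∫ t in uIoc t₀ ρ, ‖W' t / W t‖ :=
        intervalIntegral.norm_integral_le_integral_norm_uIoc
    _ ≤ ∫ t in Icc a b, ‖W' t / W t‖ := by
        refine setIntegral_mono_set hint.norm (Eventually.of_forall fun t => norm_nonneg _) ?_
        exact (uIoc_subset_uIcc.trans hsub).eventuallyLE
    _ = ∫ t in Icc a b, |W' t / W t| := by simp only [Real.norm_eq_abs]

/-- **Tonelli along the last coordinate.** For `G` integrable on `ℝⁿ⁺¹`, the fibre integrals
`x ↦ ∫ ‖G (x, t)‖ dt` are integrable on `ℝⁿ` and `t ↦ G (x, t)` is integrable for a.e. `x`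
(`MeasurableEquiv.piFinSuccAbove _ (Fin.last n)` is volume preserving with inverse
`(t, x) ↦ Fin.snoc x t`). [folklore] -/
theorem minNorm_integrable_fibre_snoc {n : ℕ} {G : (Fin (n + 1) → ℝ) → ℝ} (hG : Integrable G) :
    Integrable (fun x : Fin n → ℝ => ∫ t : ℝ, ‖G (Fin.snoc x t)‖) ∧
      ∀ᵐ x : Fin n → ℝ, Integrable (fun t : ℝ => G (Fin.snoc x t)) := by
  set e : (Fin (n + 1) → ℝ) ≃ᵐ ℝ × (Fin n → ℝ) :=
    MeasurableEquiv.piFinSuccAbove (fun _ => ℝ) (Fin.last n) with he_def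
  have he : MeasurePreserving e volume volume :=
    volume_preserving_piFinSuccAbove (fun _ => ℝ) (Fin.last n)
  have he_symm : ∀ p : ℝ × (Fin n → ℝ), e.symm p = Fin.snoc p.2 p.1 := fun p => by
    simp [he_def, MeasurableEquiv.piFinSuccAbove, Fin.snocEquiv]
  have hG2 : Integrable (fun p : ℝ × (Fin n → ℝ) => G (Fin.snoc p.2 p.1))
      ((volume : Measure ℝ).prod (volume : Measure (Fin n → ℝ))) := by
    have h := ((he.symm e).integrable_comp_emb e.symm.measurableEmbedding (g := G)).mpr hG
    rw [← Measure.volume_eq_prod]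
    convert h using 1
    ext p
    simp [he_symm]
  exact ⟨by simpa using hG2.integral_norm_prod_right, hG2.prod_left_ae⟩

/-- **Integrability of a min-normalised monomial along a section.** With the data of
`stub_minNormalisation` (band over `τ`, `V > 0` with fibre derivative `V'`, `h V'/V` integrable on
the band) and `m x = V (x, t*(x))` a fibre value, for every `ℚ`-semialgebraic section `ρ` of the
band the monomial `h · log (V(·, ρ)/m)` is integrable on `τ`: on a.e. fibre it is dominated by
`∫_{[a x, b x]} |h x V'/V| dt` (`minNorm_abs_log_div_le_integral`), whose integral over `τ` is finite by
Tonelli (`minNorm_integrable_fibre_snoc`); it is measurable as a composite of `ℚ`-semialgebraic functions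
and `log`. [folklore] -/
theorem minNorm_integrableOn_mul_log_div_section {n : ℕ} {τ : Set (Fin n → ℝ)}
    {a b ρ h m : (Fin n → ℝ) → ℝ} {V V' : (Fin (n + 1) → ℝ) → ℝ}
    (hτ : IsSemialgebraic ℚ τ) (ha : IsSemialgebraicFunOn ℚ τ a) (hb : IsSemialgebraicFunOn ℚ τ b)
    (hρ : IsSemialgebraicFunOn ℚ τ ρ) (hρmem : ∀ x ∈ τ, ρ x ∈ Icc (a x) (b x))
    (hh : IsSemialgebraicFunOn ℚ τ h) (hV : IsSemialgebraicFunOn ℚ (KZlog.band τ a b) V)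
    (hVpos : ∀ z ∈ KZlog.band τ a b, 0 < V z)
    (hVcont : ∀ x ∈ τ, ContinuousOn (fun t : ℝ => V (Fin.snoc x t)) (Icc (a x) (b x)))
    (hVder : ∀ x ∈ τ, ∀ t ∈ Ioo (a x) (b x),
      HasDerivAt (fun s : ℝ => V (Fin.snoc x s)) (V' (Fin.snoc x t)) t)
    (hint : IntegrableOn (fun z => h (Fin.init z) * V' z / V z) (KZlog.band τ a b))
    (hmsa : IsSemialgebraicFunOn ℚ τ m)
    (h1 : ∀ x ∈ τ, ∃ t ∈ Icc (a x) (b x), m x = V (Fin.snoc x t)) :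
    IntegrableOn (fun x => h x * Real.log (V (Fin.snoc x (ρ x)) / m x)) τ := by
  have hτm : MeasurableSet τ := IsSemialgebraic.measurableSet_holds hτ
  have hBm : MeasurableSet (KZlog.band τ a b) :=
    IsSemialgebraic.measurableSet_holds (KZlog.isSemialgebraic_band ha hb)
  -- the band integrand extended by zero, and its fibres
  set G : (Fin (n + 1) → ℝ) → ℝ :=
    (KZlog.band τ a b).indicator (fun z => h (Fin.init z) * V' z / V z) with hG
  have hGint : Integrable G := (integrable_indicator_iff hBm).2 hint
  obtain ⟨hnorm, hae⟩ := minNorm_integrable_fibre_snoc hGint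
  have hfib : ∀ x ∈ τ, ∀ t, G (Fin.snoc x t) =
      (Icc (a x) (b x)).indicator (fun t => h x * (V' (Fin.snoc x t) / V (Fin.snoc x t))) t := by
    intro x hx t
    by_cases ht : t ∈ Icc (a x) (b x)
    · rw [indicator_of_mem ht, hG, indicator_of_mem (KZlog.snoc_mem_band.2 ⟨hx, ht⟩)]
      simp only [Fin.init_snoc, mul_div_assoc]
    · rw [indicator_of_notMem ht, hG,
        indicator_of_notMem fun hmem => ht (KZlog.snoc_mem_band.1 hmem).2]
  -- domination on almost every fibre
  have hdom : ∀ᵐ x ∂(volume.restrict τ),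
      ‖h x * Real.log (V (Fin.snoc x (ρ x)) / m x)‖ ≤ ∫ t, ‖G (Fin.snoc x t)‖ := by
    filter_upwards [ae_restrict_mem hτm, ae_restrict_of_ae hae] with x hx hxint
    simp only [hfib x hx] at hxint ⊢
    rw [integrable_indicator_iff measurableSet_Icc] at hxint
    simp_rw [norm_indicator_eq_indicator_norm, integral_indicator measurableSet_Icc]
    by_cases hx0 : h x = 0
    · simp only [hx0, zero_mul, norm_zero, integral_zero, le_refl]
    obtain ⟨t₀, ht₀, hmt₀⟩ := h1 x hx
    have hWint : IntegrableOn (fun t => V' (Fin.snoc x t) / V (Fin.snoc x t)) (Icc (a x) (b x)) := by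
      refine IntegrableOn.congr_fun (hxint.const_mul (h x)⁻¹) (fun t _ => ?_) measurableSet_Icc
      simp only [inv_mul_cancel_left₀ hx0]
    have hest := minNorm_abs_log_div_le_integral (hVcont x hx)
      (fun t ht => hVpos _ (KZlog.snoc_mem_band.2 ⟨hx, ht⟩)) (hVder x hx) hWint (hρmem x hx) ht₀
    rw [hmt₀, norm_mul, Real.norm_eq_abs, Real.norm_eq_abs]
    simp_rw [norm_mul, integral_const_mul, Real.norm_eq_abs]
    exact mul_le_mul_of_nonneg_left hest (abs_nonneg _)
  -- measurability
  have hmeas : AEStronglyMeasurable (fun x => h x * Real.log (V (Fin.snoc x (ρ x)) / m x))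
      (volume.restrict τ) := by
    have hh' := KZ.aestronglyMeasurable_of_isSemialgebraicFunOn hh hτm
    have hm' := KZ.aestronglyMeasurable_of_isSemialgebraicFunOn hmsa hτm
    have hVρ' := KZ.aestronglyMeasurable_of_isSemialgebraicFunOn
      (minNorm_isSemialgebraicFunOn_comp_section hτ hρ hρmem hV) hτm
    exact hh'.mul (Real.measurable_log.comp_aemeasurable
      (hVρ'.aemeasurable.div hm'.aemeasurable)).aestronglyMeasurable
  exact Integrable.mono' hnorm.integrableOn hmeas hdom

/-! ### The stub -/

/-- **T1, min-normalisation.** Over a `ℚ`-semialgebraic base `τ` with edges `a ≤ b`, for `V > 0`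
`ℚ`-semialgebraic on the closed band, continuous on closed fibres and differentiable on open fibres
with derivative `V'`, and `h` `ℚ`-semialgebraic on `τ` with `h V'/V` integrable on the band: the fibre
minimum `m x = min_{t ∈ [a x, b x]} V (x, t)` is `ℚ`-semialgebraic (Tarski–Seidenberg), `0 < m ≤ V`,
and both min-normalised endpoint monomials `h · log (V(·, b)/m)`, `h · log (V(·, a)/m)` are integrable
on `τ` (each is dominated by the fibre integral of `|h V'/V|`: FTC from the argmin, Tonelli).
[folklore] -/
theorem stub_minNormalisation :
    ∀ (n : ℕ) (τ : Set (Fin n → ℝ)) (a b : (Fin n → ℝ) → ℝ) (h : (Fin n → ℝ) → ℝ)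
      (V V' : (Fin (n + 1) → ℝ) → ℝ),
      IsSemialgebraic ℚ τ → IsSemialgebraicFunOn ℚ τ a → IsSemialgebraicFunOn ℚ τ b →
      (∀ x ∈ τ, a x ≤ b x) → IsSemialgebraicFunOn ℚ τ h →
      IsSemialgebraicFunOn ℚ {z | (Fin.init z : Fin n → ℝ) ∈ τ ∧ a (Fin.init z) ≤ z (Fin.last n) ∧
        z (Fin.last n) ≤ b (Fin.init z)} V →
      (∀ z ∈ {z | (Fin.init z : Fin n → ℝ) ∈ τ ∧ a (Fin.init z) ≤ z (Fin.last n) ∧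
        z (Fin.last n) ≤ b (Fin.init z)}, 0 < V z) →
      (∀ x ∈ τ, ContinuousOn (fun t : ℝ => V (Fin.snoc x t)) (Set.Icc (a x) (b x))) →
      (∀ x ∈ τ, ∀ t ∈ Set.Ioo (a x) (b x),
        HasDerivAt (fun s : ℝ => V (Fin.snoc x s)) (V' (Fin.snoc x t)) t) →
      IntegrableOn (fun z => h (Fin.init z) * V' z / V z)
        {z | (Fin.init z : Fin n → ℝ) ∈ τ ∧ a (Fin.init z) ≤ z (Fin.last n) ∧
          z (Fin.last n) ≤ b (Fin.init z)} →
      ∃ m : (Fin n → ℝ) → ℝ, IsSemialgebraicFunOn ℚ τ m ∧ (∀ x ∈ τ, 0 < m x) ∧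
        (∀ x ∈ τ, ∀ t ∈ Set.Icc (a x) (b x), m x ≤ V (Fin.snoc x t)) ∧
        IntegrableOn (fun x => h x * Real.log (V (Fin.snoc x (b x)) / m x)) τ ∧
        IntegrableOn (fun x => h x * Real.log (V (Fin.snoc x (a x)) / m x)) τ := by
  intro n τ a b h V V' hτ ha hb hab hh hV hVpos hVcont hVder hint
  change IsSemialgebraicFunOn ℚ (KZlog.band τ a b) V at hV
  change ∀ z ∈ KZlog.band τ a b, 0 < V z at hVpos
  change IntegrableOn (fun z => h (Fin.init z) * V' z / V z) (KZlog.band τ a b) at hint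
  -- the fibre minimum, attained and a lower bound
  set m : (Fin n → ℝ) → ℝ := fun x => sInf ((fun t : ℝ => V (Fin.snoc x t)) '' Icc (a x) (b x))
    with hm
  have h2 : ∀ x ∈ τ, ∀ t ∈ Icc (a x) (b x), m x ≤ V (Fin.snoc x t) := fun x hx t ht =>
    csInf_le (isCompact_Icc.image_of_continuousOn (hVcont x hx)).bddBelow ⟨t, ht, rfl⟩
  have h1 : ∀ x ∈ τ, ∃ t ∈ Icc (a x) (b x), m x = V (Fin.snoc x t) := by
    intro x hx
    obtain ⟨s, hs, hmin⟩ := (isCompact_Icc (a := a x) (b := b x)).exists_isMinOn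
      (nonempty_Icc.2 (hab x hx)) (hVcont x hx)
    refine ⟨s, hs, le_antisymm (h2 x hx s hs) ?_⟩
    refine le_csInf ((nonempty_Icc.2 (hab x hx)).image _) ?_
    rintro _ ⟨s', hs', rfl⟩
    exact hmin hs'
  have hmsa : IsSemialgebraicFunOn ℚ τ m := minNorm_isSemialgebraicFunOn_of_fibreMin hτ hV h1 h2
  refine ⟨m, hmsa, fun x hx => ?_, h2, ?_, ?_⟩
  · obtain ⟨t, ht, hmt⟩ := h1 x hx
    rw [hmt]
    exact hVpos _ (KZlog.snoc_mem_band.2 ⟨hx, ht⟩)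
  · exact minNorm_integrableOn_mul_log_div_section hτ ha hb hb
      (fun x hx => right_mem_Icc.2 (hab x hx)) hh hV hVpos hVcont hVder hint hmsa h1
  · exact minNorm_integrableOn_mul_log_div_section hτ ha hb ha
      (fun x hx => left_mem_Icc.2 (hab x hx)) hh hV hVpos hVcont hVder hint hmsa h1

end Summit.KontsevichZagierPeriods.LiouvilleUnfolding.LogPrimitiveNL
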